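import Summits.RiemannHypothesis.RiemannHypothesis.Theorems.PfPersistenceMidpointLemma
import HarnessLib

/-!
# PF persistence — MIDPOINT LEMMA, SEGMENT and MULTI-POSITION-DIAL forms (pub-rhpf, cand-6 gen 3; ADJ-LOG A36 (i))

**HONEST FRAMING. MECHANISM / RIGIDITY campaign; no RH claims.**  Append-only companion of
`PfPersistenceMidpointLemma.lean` (tree commit 67e30c721136).  RULING A36 (i) (adj-2, 2026-08-19)
observed that the kernel dial `dial p K w` (one position) is EXACTLY the observatory's `λ`-pert object,
whereas the Arb-certified FK-DIAL(±) rows dial ALL powers `2, 4, 8, 16` of `p = 2` by one factor `K` —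
another affine direction.  This file proves the general forms so that BOTH kinds of certified
two-sided pairs instantiate a kernel statement AS TYPED, then lifts them to the whole datum:

* §1 **SEGMENT LEMMA (PROVED)** `twoSidedSegment_meets_negative`: for ANY two weight tables `w₁, w₂`
  whose even blocks at one window are both not window-positive, and any convex combination
  `s • w₁ + t • w₂` (`s, t ≥ 0`, `s + t = 1`) at whose block a convex-REJECTION predicate `P` holds,
  `P` holds at the block of `w₁` or of `w₂` — a non-positive block.  (The midpoint lemma is the case
  `w₁ = dial p K₁ w`, `w₂ = dial p K₂ w`.)
* §2 **MULTI-POSITION DIAL (PROVED)**: the `K`-parametrised segment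
  `K ↦ (q ↦ if q ∈ S then K * w q else w q)` for a finite position set `S` (e.g. `S = {2, 4, 8, 16}`:
  all powers of `2` inside every served window `a ≤ 1.65`, `e^{2a} < 32`) — `multiDial_convexCombo`
  (`w` is the explicit convex combination of its two multi-dials `K₁ < 1 < K₂`),
  `twoSidedMultiDial_meets_negative`, the datum form at `ζ` in `dialSpace`
  `twoSidedMultiDial_criterion_meets_dialNegatives`, the affine-statistic instance
  `affineStat_meets_negative_multiDial`, and `dial_eq_multiDial_singleton` (the one-position dial is
  the case `S = {p}`).  No new `def`: the multi-dial is written as a function literal throughout.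
* §3 **DATUM-LEVEL (ALL-WINDOWS) forms (PROVED)**: `datumOf_convexCombo` (the datum is affine in the
  weight table at all windows at once), `twoSidedSegment_meets_negative_datum`,
  `twoSidedDial_meets_negative_datum`, `twoSidedMultiDial_meets_negative_datum` for criteria
  `S : Set Datum` reading ANY number of windows with CONVEX REJECTION SET `Sᶜ` ("co-convex"), class
  lemma `convex_compl_exists_affine` (arbitrary disjunctions of affine acceptances of the whole
  datum), and the other side `convex_positiveClass`.
* §4 **THE CO-CONVEX BARRIER (PROVED, RH-free, no DATA)**: `coconvex_meets_dialNegativesNe` /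
  `not_separates_of_coconvex` — NO co-convex criterion separates `ζ` from the dial negatives, with
  NAMED witnesses the `2`-dials of `ζ` (`K₂ > 1` at `(log 2, 0)`: tree `exists_dial_negative_gt`;
  `K₁ < 1` at `(log 2, 1)`: `exists_dial_lt_detectablyNegative`, via `θ₁₁(log p) = −1/2` on
  `L = 2 log p`); instance `not_separates_exists_affine`.  Separating criteria therefore have
  NON-CONVEX rejection sets (the positive class is convex: its complement is the model separator).

DATA discharging the hypotheses of §§1–3 (never asserted here): single-position pairs `(2; K₁ ∈
{0.5, 0.9, 0.99}, K₂ = 1.01)` two-sided EVEN-negative at 43/44 `ζ` dial windows `a ≥ 0.45`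
(`pub-rhpf-cand-6/out/g111_midpoint_cert_v2.md`, per-pair Arb sign-certification flags listed);
multi-position pairs FK-DIAL(±) `S = {2,4,8,16}` Arb-certified on 24/24 windows `a ∈ {0.50,…,1.65}`
(CLOSED-CLASSES 'B-L1×R0 INSTANCES').  §4 needs no data.  No RH-bearing statement occurs here.
-/

set_option linter.dupNamespace false

noncomputable section

open Matrix

namespace Summit.RiemannHypothesis.RiemannHypothesis.Theorems.PfPersistence

/-! ## §1 The SEGMENT LEMMA (PROVED) -/

/-- **PROVED (SEGMENT LEMMA).**  Two weight tables `w₁, w₂` with non-window-positive even blocks at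
one window; a predicate `P` of the block with CONVEX REJECTION SET holding at the block of a convex
combination `s • w₁ + t • w₂`.  Then `P` holds at the block of `w₁` or of `w₂`, which is not
window-positive: `P` does not certify positivity at that window.  No stability / resolution input.
[folklore] -/
theorem twoSidedSegment_meets_negative (win : Window) (w₁ w₂ : Weights)
    {P : Matrix (Fin (win.N + 1)) (Fin (win.N + 1)) ℝ → Prop} (hconv : Convex ℝ {M | ¬ P M})
    {s t : ℝ} (hs : 0 ≤ s) (ht : 0 ≤ t) (hst : s + t = 1)
    (h₁ : ¬ WindowPositive (evenBlock w₁ win)) (h₂ : ¬ WindowPositive (evenBlock w₂ win))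
    (hw : P (evenBlock (s • w₁ + t • w₂) win)) :
    ∃ w' : Weights, (w' = w₁ ∨ w' = w₂) ∧ P (evenBlock w' win) ∧
      ¬ WindowPositive (evenBlock w' win) := by
  by_contra h
  have n₁ : evenBlock w₁ win ∈ {M | ¬ P M} := fun hP => h ⟨w₁, Or.inl rfl, hP, h₁⟩
  have n₂ : evenBlock w₂ win ∈ {M | ¬ P M} := fun hP => h ⟨w₂, Or.inr rfl, hP, h₂⟩
  have key := hconv n₁ n₂ hs ht hst
  rw [← evenBlock_convexCombo _ _ hst] at key
  exact key hw

/-- **PROVED (segment lemma, datum form in `dialSpace`).**  A single-window criterion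
`{d | P (d win)}` with convex rejection set that accepts the datum of a convex combination of two
weight tables with non-window-positive blocks at `win` contains a DETECTABLY NEGATIVE member of
`dialSpace`. [folklore] -/
theorem twoSidedSegment_criterion_meets_dialNegatives (win : Window) (w₁ w₂ : Weights)
    {P : Matrix (Fin (win.N + 1)) (Fin (win.N + 1)) ℝ → Prop} (hconv : Convex ℝ {M | ¬ P M})
    {s t : ℝ} (hs : 0 ≤ s) (ht : 0 ≤ t) (hst : s + t = 1)
    (h₁ : ¬ WindowPositive (datumOf w₁ win)) (h₂ : ¬ WindowPositive (datumOf w₂ win))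
    (hw : P (datumOf (s • w₁ + t • w₂) win)) :
    ∃ d ∈ dialSpace, d ∈ {d : Datum | P (d win)} ∧ DetectablyNegative d := by
  obtain ⟨w', -, hP, hneg⟩ := twoSidedSegment_meets_negative win w₁ w₂ hconv hs ht hst h₁ h₂ hw
  refine ⟨datumOf w', ⟨_, rfl⟩, hP, win, ?_⟩
  simpa [WindowPositive, datumOf, not_forall, not_le] using hneg

/-! ## §2 The K-parametrised MULTI-POSITION DIAL (PROVED) -/

/-- PROVED: the one-position dial of `PfPersistenceLocalityBarrier` is the multi-position dial with
`S = {p}`. [folklore] -/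
theorem dial_eq_multiDial_singleton (p : ℕ) (K : ℝ) (w : Weights) :
    dial p K w = fun q => if q ∈ ({p} : Finset ℕ) then K * w q else w q := by
  funext q
  simp [dial]

/-- PROVED: a weight table is the explicit CONVEX COMBINATION of its two multi-position dials on the
same finite position set `S` by factors `K₁ ≠ K₂` (coefficients `≥ 0`, summing to `1`, when
`K₁ < 1 < K₂`). [folklore] -/
theorem multiDial_convexCombo (S : Finset ℕ) (w : Weights) {K₁ K₂ : ℝ} (hK : K₁ ≠ K₂) :
    ((K₂ - 1) / (K₂ - K₁)) • (fun q => if q ∈ S then K₁ * w q else w q : Weights) +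
      ((1 - K₁) / (K₂ - K₁)) • (fun q => if q ∈ S then K₂ * w q else w q : Weights) = w := by
  have hs : K₂ - K₁ ≠ 0 := sub_ne_zero.mpr (Ne.symm hK)
  funext q
  simp only [Pi.add_apply, Pi.smul_apply, smul_eq_mul]
  split_ifs
  · field_simp
    ring
  · field_simp
    ring

/-- **PROVED (MIDPOINT LEMMA, multi-position form).**  If the two multi-position dials of `w` on a
finite position set `S` by factors `K₁ < 1 < K₂` are BOTH not window-positive at one window, every
predicate of the block with convex rejection set holding at `w`'s block holds at the block of a
multi-position dial of `w` on `S` that is not window-positive.  With `S = {p}` this is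
`twoSidedDial_meets_negative`; with `S = {2, 4, 8, 16}` it is the FK-DIAL(±) `p = 2` object of the
observatory on every window `a ≤ 1.65`. [folklore] -/
theorem twoSidedMultiDial_meets_negative (S : Finset ℕ) (win : Window) (w : Weights)
    {P : Matrix (Fin (win.N + 1)) (Fin (win.N + 1)) ℝ → Prop} (hconv : Convex ℝ {M | ¬ P M})
    {K₁ K₂ : ℝ} (hK₁ : K₁ < 1) (hK₂ : 1 < K₂)
    (h₁ : ¬ WindowPositive (evenBlock (fun q => if q ∈ S then K₁ * w q else w q) win))
    (h₂ : ¬ WindowPositive (evenBlock (fun q => if q ∈ S then K₂ * w q else w q) win))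
    (hw : P (evenBlock w win)) :
    ∃ K : ℝ, P (evenBlock (fun q => if q ∈ S then K * w q else w q) win) ∧
      ¬ WindowPositive (evenBlock (fun q => if q ∈ S then K * w q else w q) win) := by
  have hD : 0 < K₂ - K₁ := by linarith
  have hs : 0 ≤ (K₂ - 1) / (K₂ - K₁) := div_nonneg (by linarith) hD.le
  have ht : 0 ≤ (1 - K₁) / (K₂ - K₁) := div_nonneg (by linarith) hD.le
  have hst : (K₂ - 1) / (K₂ - K₁) + (1 - K₁) / (K₂ - K₁) = 1 := by
    rw [← add_div, div_eq_one_iff_eq hD.ne']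
    ring
  have hw' : P (evenBlock (((K₂ - 1) / (K₂ - K₁)) •
      (fun q => if q ∈ S then K₁ * w q else w q : Weights) +
      ((1 - K₁) / (K₂ - K₁)) • (fun q => if q ∈ S then K₂ * w q else w q : Weights)) win) := by
    rw [multiDial_convexCombo S w (by linarith : K₁ ≠ K₂)]
    exact hw
  obtain ⟨w', hw'eq, hP, hneg⟩ :=
    twoSidedSegment_meets_negative win _ _ hconv hs ht hst h₁ h₂ hw'
  rcases hw'eq with rfl | rfl
  · exact ⟨K₁, hP, hneg⟩
  · exact ⟨K₂, hP, hneg⟩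

/-- **PROVED (multi-position form, datum form at `ζ`).**  A single-window criterion with convex
rejection set accepting `ζ`, at a window where the two multi-position dials of `ζ` on `S` by
`K₁ < 1 < K₂` are not window-positive, contains a detectably negative member of `dialSpace`.
The two negativity hypotheses are DATA / Arb certificates on the served bank (module docstring),
entered as hypotheses. [folklore] -/
theorem twoSidedMultiDial_criterion_meets_dialNegatives (S : Finset ℕ) (win : Window)
    {P : Matrix (Fin (win.N + 1)) (Fin (win.N + 1)) ℝ → Prop} (hconv : Convex ℝ {M | ¬ P M})
    {K₁ K₂ : ℝ} (hK₁ : K₁ < 1) (hK₂ : 1 < K₂)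
    (h₁ : ¬ WindowPositive (datumOf (fun q => if q ∈ S then K₁ * zetaWeights q else zetaWeights q) win))
    (h₂ : ¬ WindowPositive (datumOf (fun q => if q ∈ S then K₂ * zetaWeights q else zetaWeights q) win))
    (hζ : P (zetaDatum win)) :
    ∃ d ∈ dialSpace, d ∈ {d : Datum | P (d win)} ∧ DetectablyNegative d := by
  obtain ⟨K, hPK, hneg⟩ :=
    twoSidedMultiDial_meets_negative S win zetaWeights hconv hK₁ hK₂ h₁ h₂ hζ
  refine ⟨datumOf (fun q => if q ∈ S then K * zetaWeights q else zetaWeights q), ⟨_, rfl⟩, hPK,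
    win, ?_⟩
  simpa [WindowPositive, datumOf, not_forall, not_le] using hneg

/-- PROVED: G1.11 instance, multi-position form — the affine statistic `0 ≤ Tr(A M) + c` (ANY fixed
`A`, any offset `c`) accepting `w`'s block at a window with two-sided non-positive multi-position
dials accepts a non-positive multi-position dial block. [folklore] -/
theorem affineStat_meets_negative_multiDial (S : Finset ℕ) (win : Window) (w : Weights)
    (A : Matrix (Fin (win.N + 1)) (Fin (win.N + 1)) ℝ) (c : ℝ)
    {K₁ K₂ : ℝ} (hK₁ : K₁ < 1) (hK₂ : 1 < K₂)
    (h₁ : ¬ WindowPositive (evenBlock (fun q => if q ∈ S then K₁ * w q else w q) win))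
    (h₂ : ¬ WindowPositive (evenBlock (fun q => if q ∈ S then K₂ * w q else w q) win))
    (hw : 0 ≤ Matrix.trace (A * evenBlock w win) + c) :
    ∃ K : ℝ, 0 ≤ Matrix.trace (A * evenBlock (fun q => if q ∈ S then K * w q else w q) win) + c ∧
      ¬ WindowPositive (evenBlock (fun q => if q ∈ S then K * w q else w q) win) := by
  have hconv : Convex ℝ {M : Matrix (Fin (win.N + 1)) (Fin (win.N + 1)) ℝ |
      ¬ (0 ≤ Matrix.trace (A * M) + c)} := by
    simpa only [LinearMap.comp_apply, LinearMap.mulLeft_apply, Matrix.traceLinearMap_apply] using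
      convex_not_affineNonneg
        ((Matrix.traceLinearMap (Fin (win.N + 1)) ℝ ℝ).comp (LinearMap.mulLeft ℝ A)) c
  exact twoSidedMultiDial_meets_negative S win w (P := fun M => 0 ≤ Matrix.trace (A * M) + c)
    hconv hK₁ hK₂ h₁ h₂ hw

/-! ## §3 DATUM-LEVEL (ALL-WINDOWS) forms: criteria with CONVEX REJECTION SET in the datum

`Datum = Π win, Matrix …` is a real vector space (pointwise) and `datumOf` is AFFINE in the weight
table at all windows simultaneously (`datumOf_convexCombo`).  Hence the segment / dial lemmas lift
verbatim from one window to CRITERIA `S : Set Datum` reading ANY NUMBER OF WINDOWS whose REJECTION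
SET `Sᶜ` is convex ("co-convex criteria": one affine functional of the whole datum — weighted sums /
differences of `Tr(A_win · d win)` ACROSS windows, i.e. transport-affine readers; arbitrary, even
infinite, DISJUNCTIONS `∃ i, 0 ≤ φᵢ d + cᵢ` of affine acceptances (`convex_compl_exists_affine`);
quasi-concave acceptance).  The negativity hypotheses are now `DetectablyNegative` (at SOME window,
not necessarily one the criterion reads). -/

/-- PROVED: the datum is AFFINE in the weight table — all windows at once. [folklore] -/
theorem datumOf_convexCombo (w₁ w₂ : Weights) {s t : ℝ} (hst : s + t = 1) :
    datumOf (s • w₁ + t • w₂) = s • datumOf w₁ + t • datumOf w₂ := by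
  funext win
  simp only [datumOf, Pi.add_apply, Pi.smul_apply]
  exact evenBlock_convexCombo w₁ w₂ hst win

/-- **PROVED (SEGMENT LEMMA, datum level).**  `S ⊆ Datum` with convex complement; two weight tables
with DETECTABLY NEGATIVE data; a convex combination of them whose datum lies in `S`.  Then the datum
of one of the two lies in `S` — `S` accepts a detectably negative member of `dialSpace`. [folklore] -/
theorem twoSidedSegment_meets_negative_datum {S : Set Datum} (hconv : Convex ℝ Sᶜ)
    (w₁ w₂ : Weights) {s t : ℝ} (hs : 0 ≤ s) (ht : 0 ≤ t) (hst : s + t = 1)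
    (h₁ : DetectablyNegative (datumOf w₁)) (h₂ : DetectablyNegative (datumOf w₂))
    (hw : datumOf (s • w₁ + t • w₂) ∈ S) :
    ∃ w' : Weights, (w' = w₁ ∨ w' = w₂) ∧ datumOf w' ∈ S ∧ DetectablyNegative (datumOf w') := by
  by_contra h
  have n₁ : datumOf w₁ ∈ Sᶜ := fun hS => h ⟨w₁, Or.inl rfl, hS, h₁⟩
  have n₂ : datumOf w₂ ∈ Sᶜ := fun hS => h ⟨w₂, Or.inr rfl, hS, h₂⟩
  have key := hconv n₁ n₂ hs ht hst
  rw [← datumOf_convexCombo _ _ hst] at key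
  exact key hw

/-- **PROVED (TWO-SIDED DIAL, datum level).**  If the two `p`-dials of `w` by `K₁ < 1 < K₂` have
detectably negative data and a co-convex criterion `S` accepts `datumOf w`, then `S` accepts the
datum of one of the two dials (`K ≠ 1`, detectably negative). [folklore] -/
theorem twoSidedDial_meets_negative_datum (p : ℕ) (w : Weights) {S : Set Datum}
    (hconv : Convex ℝ Sᶜ) {K₁ K₂ : ℝ} (hK₁ : K₁ < 1) (hK₂ : 1 < K₂)
    (h₁ : DetectablyNegative (datumOf (dial p K₁ w)))
    (h₂ : DetectablyNegative (datumOf (dial p K₂ w))) (hw : datumOf w ∈ S) :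
    ∃ K : ℝ, K ≠ 1 ∧ datumOf (dial p K w) ∈ S ∧ DetectablyNegative (datumOf (dial p K w)) := by
  have hD : 0 < K₂ - K₁ := by linarith
  have hs : 0 ≤ (K₂ - 1) / (K₂ - K₁) := div_nonneg (by linarith) hD.le
  have ht : 0 ≤ (1 - K₁) / (K₂ - K₁) := div_nonneg (by linarith) hD.le
  have hst : (K₂ - 1) / (K₂ - K₁) + (1 - K₁) / (K₂ - K₁) = 1 := by
    rw [← add_div, div_eq_one_iff_eq hD.ne']
    ring
  have hw' : datumOf (((K₂ - 1) / (K₂ - K₁)) • dial p K₁ w +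
      ((1 - K₁) / (K₂ - K₁)) • dial p K₂ w) ∈ S := by
    rw [dial_convexCombo p w (by linarith : K₁ ≠ K₂)]
    exact hw
  obtain ⟨w', hw'eq, hS, hneg⟩ :=
    twoSidedSegment_meets_negative_datum hconv _ _ hs ht hst h₁ h₂ hw'
  rcases hw'eq with rfl | rfl
  · exact ⟨K₁, hK₁.ne, hS, hneg⟩
  · exact ⟨K₂, hK₂.ne', hS, hneg⟩

/-- **PROVED (MULTI-POSITION DIAL, datum level, at `ζ`).**  With the two multi-position dials of `ζ`
on `S₀` by `K₁ < 1 < K₂` detectably negative (DATA on the served bank for `S₀ = {2}`, `{2,4,8,16}`: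
module docstring), every co-convex criterion accepting `ζ` accepts a detectably negative member of
`dialSpace`. [folklore] -/
theorem twoSidedMultiDial_meets_negative_datum (S₀ : Finset ℕ) {S : Set Datum}
    (hconv : Convex ℝ Sᶜ) {K₁ K₂ : ℝ} (hK₁ : K₁ < 1) (hK₂ : 1 < K₂)
    (h₁ : DetectablyNegative (datumOf (fun q => if q ∈ S₀ then K₁ * zetaWeights q else zetaWeights q)))
    (h₂ : DetectablyNegative (datumOf (fun q => if q ∈ S₀ then K₂ * zetaWeights q else zetaWeights q)))
    (hζ : zetaDatum ∈ S) :
    ∃ d ∈ dialSpace, d ∈ S ∧ DetectablyNegative d := by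
  have hD : 0 < K₂ - K₁ := by linarith
  have hs : 0 ≤ (K₂ - 1) / (K₂ - K₁) := div_nonneg (by linarith) hD.le
  have ht : 0 ≤ (1 - K₁) / (K₂ - K₁) := div_nonneg (by linarith) hD.le
  have hst : (K₂ - 1) / (K₂ - K₁) + (1 - K₁) / (K₂ - K₁) = 1 := by
    rw [← add_div, div_eq_one_iff_eq hD.ne']
    ring
  have hw' : datumOf (((K₂ - 1) / (K₂ - K₁)) •
      (fun q => if q ∈ S₀ then K₁ * zetaWeights q else zetaWeights q : Weights) +
      ((1 - K₁) / (K₂ - K₁)) •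
      (fun q => if q ∈ S₀ then K₂ * zetaWeights q else zetaWeights q : Weights)) ∈ S := by
    rw [multiDial_convexCombo S₀ zetaWeights (by linarith : K₁ ≠ K₂)]
    exact hζ
  obtain ⟨w', -, hS, hneg⟩ :=
    twoSidedSegment_meets_negative_datum hconv _ _ hs ht hst h₁ h₂ hw'
  exact ⟨datumOf w', ⟨_, rfl⟩, hS, hneg⟩

/-- PROVED (class lemma, datum level): an arbitrary — possibly infinite — DISJUNCTION of affine
acceptances `∃ i, 0 ≤ φᵢ(d) + cᵢ` (each `φᵢ` a real-linear functional of the WHOLE datum, e.g.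
`d ↦ Tr(A · d win) − Tr(B · d win')` across two windows, or "some window passes the affine test")
has a convex rejection set. [folklore] -/
theorem convex_compl_exists_affine {ι : Sort*} (φ : ι → Datum →ₗ[ℝ] ℝ) (c : ι → ℝ) :
    Convex ℝ {d : Datum | ∃ i, 0 ≤ φ i d + c i}ᶜ := by
  have h : {d : Datum | ∃ i, 0 ≤ φ i d + c i}ᶜ = ⋂ i, {d : Datum | ¬ (0 ≤ φ i d + c i)} := by
    ext d
    simp only [Set.mem_compl_iff, Set.mem_setOf_eq, not_exists, Set.mem_iInter]
  rw [h]
  exact convex_iInter fun i => convex_not_affineNonneg (φ i) (c i)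

/-- PROVED (the other side, datum level): the POSITIVE CLASS itself is CONVEX — its complement is
not, so the tautological separator of T-W3 is not co-convex, as it must be. [folklore] -/
theorem convex_positiveClass : Convex ℝ positiveClass := by
  intro d₁ h₁ d₂ h₂ s t hs ht _
  simp only [positiveClass, AllWindowsPositive, Set.mem_setOf_eq] at h₁ h₂ ⊢
  intro win
  have e : (s • d₁ + t • d₂) win = s • d₁ win + t • d₂ win := rfl
  rw [e]
  exact convex_windowPositive _ (h₁ win) (h₂ win) hs ht (by assumption)

/-! ## §4 The CO-CONVEX BARRIER — RH-free, no DATA, all windows (PROVED)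

Both negativity hypotheses of §3 can be DISCHARGED BY THEOREM inside `dialSpace` AS TYPED: the UP
dial of `ζ` at `p = 2` is detectably negative for some `K₂ > 1` at the genuine window `(log 2, 0)`
(tree `exists_dial_negative_gt`: the `(0,0)` entry is affine in `K` with negative slope), and the
DOWN dial is detectably negative for some `K₁ < 1` at the genuine window `(log 2, 1)`
(`exists_dial_lt_detectablyNegative` below: the `(1,1)` pattern entry is `θ₁₁(log p) = −1/2` when
`L = 2 log p`, so the `(1,1)` entry is affine in `K` with POSITIVE slope `w(p)`).  HONEST LABEL: the
down witness has `K₁ < 0` in general (a sign-reversed weight at `p`) — a member of `dialSpace` and of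
the prime-power table space as typed, NOT an observatory control family (the served down-dials
`K ∈ {0.5, 0.9, 0.99}` are negative by DATA, §3 applies to them with `h₁`, `h₂` as hypotheses). -/

/-- PROVED: the Rayleigh value of a basis vector is the diagonal entry. [folklore] -/
theorem single_rayleigh {n : ℕ} (M : Matrix (Fin n) (Fin n) ℝ) (i : Fin n) :
    (Pi.single i 1 : Fin n → ℝ) ⬝ᵥ (M *ᵥ Pi.single i 1) = M i i := by
  simp [Matrix.mulVec, dotProduct, Pi.single_apply]

/-- PROVED: `θ₁₁(y) = −1/2` on the support of length `L = 2y` (`cos π = −1`, `sin π = 0`). [folklore] -/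
theorem thetaEven_one_one_self {y : ℝ} (hy : y ≠ 0) : thetaEven (2 * y) 1 1 y = -(1 / 2) := by
  have h2y : (2 : ℝ) * y ≠ 0 := mul_ne_zero two_ne_zero hy
  have hπ : 2 * Real.pi * ((1 : ℕ) : ℝ) * y / (2 * y) = Real.pi := by
    rw [div_eq_iff h2y]
    push_cast
    ring
  unfold thetaEven
  rw [if_neg (by norm_num), if_neg (by norm_num), if_neg (by norm_num), if_pos rfl, hπ, Real.cos_pi,
    Real.sin_pi, zero_div, sub_zero]
  have hfrac : (2 * y - y) / (2 * y) = 1 / 2 := by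
    rw [div_eq_iff h2y]
    ring
  rw [hfrac]
  norm_num

/-- **PROVED (RH-free DOWN witness).**  For a weight table with `w(p) > 0`, `p ≥ 2`, some `K < 1`
makes the `p`-dial DETECTABLY NEGATIVE: at the genuine window `(a, N) = (log p, 1)` the basis vector
`e₁` has Rayleigh value `Q_w(win)₁₁ + (K − 1) w(p) → −∞` as `K → −∞`. [folklore] -/
theorem exists_dial_lt_detectablyNegative {p : ℕ} (hp : 2 ≤ p) {w : Weights} (hw : 0 < w p) :
    ∃ K : ℝ, K < 1 ∧ DetectablyNegative (datumOf (dial p K w)) := by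
  have hp1 : (1 : ℝ) < p := by exact_mod_cast (by omega : 1 < p)
  have hlog : 0 < Real.log p := Real.log_pos hp1
  obtain ⟨win, hwin⟩ : ∃ win : Window, win = ⟨Real.log p, 1, hlog⟩ := ⟨_, rfl⟩
  have hwa : win.a = Real.log p := by rw [hwin]
  have hmem : p ∈ primeRange (2 * win.a) := mem_primeRange_of_log_le (by rw [hwa]; linarith)
  subst hwin
  obtain ⟨c, hc⟩ : ∃ c : ℝ, c = evenBlock w ⟨Real.log p, 1, hlog⟩ 1 1 := ⟨_, rfl⟩
  have hKpos : 0 < (max c 0 + 1) / w p := div_pos (by linarith [le_max_right c 0]) hw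
  refine ⟨1 - (max c 0 + 1) / w p, by linarith, ⟨Real.log p, 1, hlog⟩, Pi.single 1 1, ?_⟩
  show (Pi.single 1 1 : Fin 2 → ℝ) ⬝ᵥ
      (evenBlock (dial p (1 - (max c 0 + 1) / w p) w) ⟨Real.log p, 1, hlog⟩ *ᵥ Pi.single 1 1) < 0
  rw [single_rayleigh, evenBlock_dial_apply hmem, ← hc]
  have hθ : thetaEven (2 * (⟨Real.log p, 1, hlog⟩ : Window).a) ((1 : Fin 2) : ℕ) ((1 : Fin 2) : ℕ)
      (Real.log p) = -(1 / 2) := by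
    show thetaEven (2 * Real.log p) 1 1 (Real.log p) = -(1 / 2)
    exact thetaEven_one_one_self hlog.ne'
  rw [hθ]
  have hval : 2 * (1 - (max c 0 + 1) / w p - 1) * w p * -(1 / 2) = max c 0 + 1 := by
    field_simp
    ring
  rw [hval]
  linarith [le_max_left c 0]

/-- PROVED (RH-free UP witness, datum form of the tree's `exists_dial_negative_gt` at `(log p, 0)`). [folklore] -/
theorem exists_dial_gt_detectablyNegative {p : ℕ} (hp : 2 ≤ p) {w : Weights} (hw : 0 < w p) :
    ∃ K : ℝ, 1 < K ∧ DetectablyNegative (datumOf (dial p K w)) := by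
  have hp1 : (1 : ℝ) < p := by exact_mod_cast (by omega : 1 < p)
  obtain ⟨K, hK, v, hv⟩ := exists_dial_negative_gt (win := logWindow p hp) (logWindow p hp).ha
    (by rw [logWindow_a]; linarith [Real.log_pos hp1]) hw
  exact ⟨K, hK, logWindow p hp, v, hv⟩

/-- **PROVED — THE CO-CONVEX BARRIER (RH-free; no DATA input; every window at once; no topology).**
No criterion `S ⊆ Datum` whose REJECTION SET is convex contains `ζ`'s datum and misses the
detectably negative part of the dial space: `S` contains the datum of a `2`-dial of `ζ` with `K ≠ 1`
(so `≠ ζ`) that is detectably negative at a genuine window.  Equivalently: every criterion that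
separates `ζ` from the dial negatives has a NON-CONVEX rejection set. [folklore] -/
theorem coconvex_meets_dialNegativesNe {S : Set Datum} (hconv : Convex ℝ Sᶜ) (hζ : zetaDatum ∈ S) :
    ∃ d ∈ dialSpace, d ≠ zetaDatum ∧ d ∈ S ∧ DetectablyNegative d := by
  have h2 : 0 < zetaWeights 2 := zetaWeights_pos_of_prime Nat.prime_two
  obtain ⟨K₁, hK₁, hneg₁⟩ := exists_dial_lt_detectablyNegative (p := 2) le_rfl h2
  obtain ⟨K₂, hK₂, hneg₂⟩ := exists_dial_gt_detectablyNegative (p := 2) le_rfl h2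
  obtain ⟨K, hK, hS, hneg⟩ :=
    twoSidedDial_meets_negative_datum 2 zetaWeights hconv hK₁ hK₂ hneg₁ hneg₂ hζ
  exact ⟨_, ⟨_, rfl⟩, datumOf_dial_ne le_rfl hK h2.ne', hS, hneg⟩

/-- PROVED: hence NO co-convex criterion separates `ζ` from the negatives of any domain
`D ⊇ dialSpace` (RH-free). [folklore] -/
theorem not_separates_of_coconvex {S D : Set Datum} (hD : dialSpace ⊆ D) (hconv : Convex ℝ Sᶜ) :
    ¬ Separates S D zetaDatum := by
  rintro ⟨hζ, hsep⟩
  obtain ⟨d, hdD, -, hdS, hd⟩ := coconvex_meets_dialNegativesNe hconv hζ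
  exact hsep d (hD hdD) hd hdS

/-- PROVED (instance): no disjunction — over any index set — of affine acceptances of the whole
datum separates `ζ` from the dial negatives. [folklore] -/
theorem not_separates_exists_affine {ι : Sort*} (φ : ι → Datum →ₗ[ℝ] ℝ) (c : ι → ℝ) {D : Set Datum}
    (hD : dialSpace ⊆ D) : ¬ Separates {d : Datum | ∃ i, 0 ≤ φ i d + c i} D zetaDatum :=
  not_separates_of_coconvex hD (convex_compl_exists_affine φ c)

end Summit.RiemannHypothesis.RiemannHypothesis.Theorems.PfPersistence

end
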